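import Literature.AnabelianGeometry.EtaleTheta.SettingModelQNonSquare
import HarnessLib

/-!
# The clause "`K = K̈`" of `ThetaSetting.Sec2Hyps` is independent of the [EtTh] §1 root interface EVEN GIVEN
# `hYcl`: the FINER root model with `q_X := p` (kernel countermodel; no new Prop facts)

Mochizuki, *The étale theta function …*, Publ. RIMS **45** (2009) [EtTh]: Def. 2.5 p. 39 ("`K = K̈`", cf.
Def. 1.7 (I) p. 27: `K̈ = K(ζ₂, q_X^{1/2})`); §1 p. 13 (`K_N := K(ζ_N, q_X^{1/N})`, the coverings `Y_N`); pp. 12–13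
(the closedness binder `hYcl`, GAP-LEDGER G-w4d021-2) [cite: MochizukiEtTh2009, Def 2.5 p.39].

abc-iut cell, layer L2 / K-L6 slice (bundle `ThetaSetting.Sec2Hyps`, FACT-LIST F-2511), seat abc-iut-w6-d092
(gen 5); sequel to `SettingModelQNonSquare.lean` (same seat: `ThetaSetting.not_forall_Kdd_eq` — clause (a) is
independent of {root, guard, clause (b)} at the DISCRETE root model with `q_X := p`, where `hYcl` fails). THIS FILE
redoes the construction at abc-iut-L2-t1's FINER root model `ThetaSetting.model₂ p` (`SettingModel2.lean`,
`Π^tp_X := (F̂₂ ×_Ẑ ℤ) × G_{ℚ_p}`, where `hYcl` HOLDS): `ThetaSetting.model₂Q p` = `model₂ p` with `q_X := p`,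
`q̈ := p^{1/2}`, `K_N := ℚ_p(μ_N, p^{1/N})` (the Galois sides `gKNq`, `gJNq` of `SettingModelQNonSquare`), the
`Y`/`Z`-lattices `dY`, `dZ` and the theta quotients unchanged. Every root axiom holds; the guard, `hYcl`, `Compat`
and clause (b) hold (`ker_toEll_inf_GtpY_le_GtpYN_model₂Q`, abc-iut-L2-d1's level-wise class-1 shadow); but
`K̈ = ℚ_p(±1, ±√p) ≠ ℚ_p = K` (`model₂Q_Kdd_ne`). Hence
**`ThetaSetting.not_forall_Kdd_eq_of_hYcl`**: `¬ ∀ D, D.IsEtThOrigin → hYcl D → (b) → D.Kdd = D.K`, and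
**`ThetaSetting.KddClause_independent_hYcl`** (`model₂ p` ⊨ (a), `model₂Q p` ⊨ ¬(a), both ⊨ guard ∧ hYcl ∧ (b)).
Together with `SettingModel2YTwist.lean`: NEITHER clause of `Sec2Hyps` is a lemma of {root, guard, `hYcl`, the
other clause} — all the `D`-level standing binders of the §2 consumers. HONEST LIMITS: independence evidence
about OUR typed interface only (`E`-level binders are root-vacuous and not tested); nothing of [EtTh] asserted or
denied; no side taken on [IUTchIII] Cor. 3.12. No instances on existing types; no Prop facts; `model₂Q` is an
explicit inhabitant of the existing structure `ThetaSetting p`.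
-/

noncomputable section

namespace Literature.AnabelianGeometry.EtaleTheta.SettingModel

open Literature.AnabelianGeometry.SemiGraphs
open Function
open scoped commutatorElement

variable (p : ℕ) [Fact p.Prime]

/-- `p ∈ ℚ_p ⊆ ℚ̄_p`. [folklore] -/
private theorem natCast_mem_bot₄ : ((p : ℕ) : PadicAlgCl p) ∈ (⊥ : IntermediateField ℚ_[p] (PadicAlgCl p)) :=
  IntermediateField.natCast_mem _ p

/-- `p ≠ 0` in `ℚ̄_p`. [folklore] -/
private theorem natCast_ne_zero₄ : ((p : ℕ) : PadicAlgCl p) ≠ 0 :=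
  Nat.cast_ne_zero.mpr (Fact.out : p.Prime).ne_zero

/-- [folklore] -/
private theorem map_aug_prod₄ (A : Subgroup Gfp) (B : Subgroup (GQp p)) :
    (A.prod (B.comap (Gam.toGQp p).toMonoidHom)).map (curve₂ p).aug.toMonoidHom = B := by
  ext σ
  constructor
  · rintro ⟨x, ⟨-, hx⟩, rfl⟩; exact hx
  · intro hσ; exact ⟨((1 : Gfp), (σ : Gam p)), ⟨A.one_mem, hσ⟩, rfl⟩

/-- [folklore] -/
private theorem prod_inf_deltaTemp₄ (A : Subgroup Gfp) (B : Subgroup (Gam p)) :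
    A.prod B ⊓ (curve₂ p).aug.toMonoidHom.ker = A.prod ⊥ := by
  ext g
  rw [Subgroup.mem_inf, Subgroup.mem_prod, Subgroup.mem_prod, Subgroup.mem_bot]
  constructor
  · rintro ⟨⟨h1, -⟩, h3⟩; exact ⟨h1, (mem_deltaTemp₂_iff p g).mp h3⟩
  · rintro ⟨h1, h2⟩; exact ⟨⟨h1, by rw [h2]; exact B.one_mem⟩, (mem_deltaTemp₂_iff p g).mpr h2⟩

/-- [folklore] -/
private theorem relIndex_prod_bot₄ (A' A : Subgroup Gfp) :
    ((A'.prod (⊥ : Subgroup (Gam p))).relIndex (A.prod ⊥)) = A'.relIndex A := by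
  have h1 : ∀ B : Subgroup Gfp, B.prod (⊥ : Subgroup (Gam p)) = B.map (MonoidHom.inl Gfp (Gam p)) := by
    intro B; ext x; constructor
    · rintro ⟨hx1, hx2⟩; exact ⟨x.1, hx1, Prod.ext rfl ((Subgroup.mem_bot.mp hx2).symm)⟩
    · rintro ⟨b, hb, rfl⟩; exact ⟨hb, Subgroup.mem_bot.mpr rfl⟩
  have hinj : Injective (MonoidHom.inl Gfp (Gam p)) := fun a b h => congrArg Prod.fst h
  have h2 := Subgroup.relIndex_comap (A'.map (MonoidHom.inl Gfp (Gam p))) (MonoidHom.inl Gfp (Gam p)) A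
  rw [Subgroup.comap_map_eq_self_of_injective hinj] at h2
  rw [h1, h1, ← h2]

/-! ### The coverings of the finer model over `K_N = ℚ_p(μ_N, p^{1/N})`, `J_N` -/

/-- `Π^tp_{Y_N} := Δ^tp_{Y_N} × G_{K_N}`, `K_N = ℚ_p(μ_N, p^{1/N})` (finer model, `q_X := p`).
[cite: MochizukiEtTh2009, §1 p.13] -/
def YN₂q (N : ℕ+) : Subgroup (PiTp₂ p) := (dY N).prod (gKNq p N)

/-- `Π^tp_{Z_N} := Δ^tp_{Z_N} × G_{J_N}` (finer model, `q_X := p`). [cite: MochizukiEtTh2009, §1 p.14] -/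
def ZN₂q (N : ℕ+) : Subgroup (PiTp₂ p) := (dZ N).prod (gJNq p N)

/-- [cite: MochizukiEtTh2009, §1 p.14] -/
theorem YN₂q_one : YN₂q p 1 = (toZM₂ p).ker := by
  rw [ker_toZM₂, YN₂q, dY_one, gKNq, fieldKN_bot_one _ (natCast_mem_bot₄ p), IntermediateField.fixingSubgroup_bot,
    Subgroup.comap_top]

/-- [cite: MochizukiEtTh2009, §1 p.13] -/
theorem YN₂q_le (N : ℕ+) : YN₂q p N ≤ (toZM₂ p).ker := by
  rw [ker_toZM₂]; exact Subgroup.prod_mono (dY_le N) le_top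

/-- [cite: MochizukiEtTh2009, §1 p.14] -/
theorem YN₂q_normal (N : ℕ+) : (YN₂q p N).Normal := by
  haveI := dY_normal N
  haveI := fixingSubgroup_fieldKN_bot_normal _ (natCast_mem_bot₄ p) N
  haveI : (gKNq p N).Normal := Subgroup.Normal.comap inferInstance _
  exact Subgroup.prod_normal _ _

/-- [cite: MochizukiEtTh2009, §1 p.15] -/
theorem ZN₂q_normal (N : ℕ+) : (ZN₂q p N).Normal := by
  haveI := dZ_normal N
  haveI := fixingSubgroup_fieldJN_bot_normal _ (natCast_mem_bot₄ p) N
  haveI : (gJNq p N).Normal := Subgroup.Normal.comap inferInstance _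
  exact Subgroup.prod_normal _ _

/-- [cite: MochizukiEtTh2009, §1 p.13] -/
theorem isOpen_YN₂q (N : ℕ+) : IsOpen (YN₂q p N : Set (PiTp₂ p)) := by
  rw [YN₂q, Subgroup.coe_prod]; exact (isOpen_dY N).prod (isOpen_discrete _)

/-- [cite: MochizukiEtTh2009, §1 p.14] -/
theorem isOpen_ZN₂q (N : ℕ+) : IsOpen (ZN₂q p N : Set (PiTp₂ p)) := by
  rw [ZN₂q, Subgroup.coe_prod]; exact (isOpen_dZ N).prod (isOpen_discrete _)

/-! ### The inhabitant `ThetaSetting.model₂Q p` and the failure of clause (a) -/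

/-- **The finer root model with `q_X := p`**: abc-iut-L2-t1's `ThetaSetting.model₂ p` with the `q`-parameter `p`
(not a square in `ℚ_p`), `q̈ := p^{1/2}`, `K_N := ℚ_p(μ_N, p^{1/N})`, `J_N` accordingly; `Π^tp_X`, the theta
quotients, the `Y`/`Z`-lattices unchanged. Consistency / independence evidence only. [cite: MochizukiEtTh2009, §1 p.13] -/
abbrev _root_.Literature.AnabelianGeometry.EtaleTheta.ThetaSetting.model₂Q : ThetaSetting p where
  toTemperedCurve := curve₂ p
  qX := ((p : ℕ) : PadicAlgCl p)
  qX_mem := natCast_mem_bot₄ p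
  norm_qX_lt_one := (ThetaSetting.modelQ p).norm_qX_lt_one
  qX_ne_zero := natCast_ne_zero₄ p
  sqrtqX := sqrtP p
  sqrtqX_sq := sqrtP_sq p
  toZ := toZM₂ p
  toZ_surjective := toZM₂_surjective p
  isOpen_ker_toZ := isOpen_ker_toZM₂ p
  toZ_delta_surjective := toZM₂_delta_surjective p
  GtpTheta := GTheta₂ p
  toTheta := toThetaM₂ p
  continuous_toTheta := (ThetaSetting.model₂ p).continuous_toTheta
  toTheta_surjective := QuotientGroup.mk'_surjective _
  ker_toTheta := QuotientGroup.ker_mk' _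
  GtpEll := GEll₂ p
  thetaToEll := thetaToEllM₂ p
  continuous_thetaToEll := (ThetaSetting.model₂ p).continuous_thetaToEll
  thetaToEll_surjective := (ThetaSetting.model₂ p).thetaToEll_surjective
  ker_toEll := ker_toEllM₂ p
  ker_thetaToEll_comm := ker_thetaToEllM₂_comm p
  ker_thetaToEll_central := ker_thetaToEllM₂_central p
  GtpYN := YN₂q p
  GtpYN_one := YN₂q_one p
  GtpYN_le := YN₂q_le p
  map_aug_GtpYN N := map_aug_prod₄ p _ _
  GtpYN_normal := YN₂q_normal p
  isOpen_GtpYN := isOpen_YN₂q p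
  GtpYN_anti M N h := Subgroup.prod_mono (dY_anti h)
    (Subgroup.comap_mono (IntermediateField.fixingSubgroup_antitone (fieldKN_bot_mono _ (natCast_ne_zero₄ p) h)))
  relIndex_deltaYN N := by
    rw [ker_toZM₂, YN₂q, prod_inf_deltaTemp₄, prod_inf_deltaTemp₄, relIndex_prod_bot₄, relIndex_dY]
  GtpZN := ZN₂q p
  GtpZN_le N := Subgroup.prod_mono (dZ_le_dY N)
    (Subgroup.comap_mono (IntermediateField.fixingSubgroup_antitone (fieldKN_le_fieldJN _ ⊥ N)))
  map_aug_GtpZN N := map_aug_prod₄ p _ _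
  GtpZN_normal := ZN₂q_normal p
  isOpen_GtpZN := isOpen_ZN₂q p
  GtpZN_anti M N h := Subgroup.prod_mono (dZ_anti h)
    (Subgroup.comap_mono (IntermediateField.fixingSubgroup_antitone (fieldJN_bot_mono _ (natCast_ne_zero₄ p) h)))
  relIndex_deltaZN N := by
    rw [ZN₂q, YN₂q, prod_inf_deltaTemp₄, prod_inf_deltaTemp₄, relIndex_prod_bot₄, relIndex_dZ]
  ker_toTheta_le_GtpZN N := by
    intro g hg'
    obtain ⟨hg, hgY⟩ := Subgroup.mem_inf.mp hg'
    rw [toThetaM₂, QuotientGroup.ker_mk'] at hg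
    obtain ⟨h1, h2⟩ := hHat_eq_one_and_snd_eq_one_of_mem_KTheta₂ p hg N
    have hgY1 : g.1 ∈ gfpSnd.ker := (Subgroup.mem_inf.mp (Subgroup.mem_prod.mp hgY).1).1
    refine Subgroup.mem_prod.mpr ⟨Subgroup.mem_inf.mpr ⟨hgY1, ?_⟩, ?_⟩
    · rw [MonoidHom.mem_ker]; exact h1
    · show g.2 ∈ gJNq p N
      rw [h2]; exact (gJNq p N).one_mem

/-- `model₂Q` satisfies the guard. [cite: MochizukiEtTh2009, §1 p.12] -/
theorem _root_.Literature.AnabelianGeometry.EtaleTheta.ThetaSetting.model₂Q_isEtThOrigin :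
    (ThetaSetting.model₂Q p).IsEtThOrigin :=
  ThetaSetting.IsEtThOrigin.of_free (isFreeProfiniteOnTwo_deltaHat₂ p)

/-- `model₂Q` satisfies `Compat`. [cite: MochizukiEtTh2009, §1 p.22] -/
theorem _root_.Literature.AnabelianGeometry.EtaleTheta.ThetaSetting.model₂Q_compat :
    (ThetaSetting.model₂Q p).Compat :=
  (ThetaSetting.model₂Q p).compat

/-- **`hYcl` HOLDS at `model₂Q`** (same `Δ^tp_Y`, `Π^tp_X → Π_X`, `Δ_X` as `model₂ p`; abc-iut-L2-t1 `hYcl_model₂`).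
[cite: MochizukiEtTh2009, §1 p.12] -/
theorem hYcl_model₂Q :
    ((ThetaSetting.model₂Q p).DtpY.map (ThetaSetting.model₂Q p).toHat.toMonoidHom).topologicalClosure ≤
      (ThetaSetting.model₂Q p).DtpY.map (ThetaSetting.model₂Q p).toHat.toMonoidHom ⊔
        (⁅⁅(ThetaSetting.model₂Q p).DeltaHat, (ThetaSetting.model₂Q p).DeltaHat⁆,
          (ThetaSetting.model₂Q p).DeltaHat⁆).topologicalClosure :=
  hYcl_model₂ p

/-- **Clause (b) of `Sec2Hyps` HOLDS at `model₂Q`**: an element of `Ker(Π^tp_X ↠ (Π^tp_X)^ell)` has `x = y = 0` at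
every level and trivial Galois component (abc-iut-L2-t1's `mem_KEll₂_iff`), hence lies in `Δ^tp_{Y_N} × G_{K_N}`
once it is in `Π^tp_Y`. [cite: MochizukiEtTh2009, §1 p.13] -/
theorem ker_toEll_inf_GtpY_le_GtpYN_model₂Q (N : ℕ+) :
    ((ThetaSetting.model₂Q p).thetaToEll.comp (ThetaSetting.model₂Q p).toTheta).ker ⊓
        (ThetaSetting.model₂Q p).GtpY ≤ (ThetaSetting.model₂Q p).GtpYN N := by
  intro g hg
  have hg1 : g ∈ KEll₂ p := by
    rw [← ker_toEllM₂ p]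
    exact hg.1
  have hgZ : g ∈ (toZM₂ p).ker := hg.2
  obtain ⟨hxy, h2⟩ := (mem_KEll₂_iff p g).mp hg1
  rw [ker_toZM₂] at hgZ
  refine ⟨⟨hgZ.1, ?_⟩, ?_⟩
  · change levelHom N g.1 ∈ (Heis.zAxis : Subgroup (Heis (ZMod N)))
    exact hxy N
  · change g.2 ∈ gKNq p N
    rw [h2]
    exact (gKNq p N).one_mem

/-- **`K̈ ≠ K` at `model₂Q`**: `√p ∈ K̈ = K_2`, `√p ∉ ℚ_p = K` — clause (a) FAILS. [cite: MochizukiEtTh2009, Def 2.5 p.39] -/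
theorem model₂Q_Kdd_ne : (ThetaSetting.model₂Q p).Kdd ≠ (ThetaSetting.model₂Q p).K := by
  change fieldKN ⊥ ((p : ℕ) : PadicAlgCl p) 2 ≠ ⊥
  intro h
  have hmem : sqrtP p ∈ fieldKN ⊥ ((p : ℕ) : PadicAlgCl p) 2 := by
    unfold fieldKN
    refine IntermediateField.subset_adjoin _ _ (Or.inr (Or.inr ?_))
    simp [sqrtP_sq]
  rw [h] at hmem
  exact sqrtP_not_mem_bot p hmem

/-- **`model₂Q` does NOT satisfy `Sec2Hyps`.** [cite: MochizukiEtTh2009, Def 2.5 p.39] -/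
theorem _root_.Literature.AnabelianGeometry.EtaleTheta.ThetaSetting.not_sec2Hyps_model₂Q :
    ¬ (ThetaSetting.model₂Q p).Sec2Hyps :=
  fun h => model₂Q_Kdd_ne p h.Kdd_eq

/-- **UNIVERSAL CLOSURE OF CLAUSE (a) REFUTED over {root, guard, `hYcl`, clause (b)}**: "`K = K̈`" is NOT a
consequence of the root interface, `IsEtThOrigin`, the closedness binder `hYcl` (G-w4d021-2) and clause (b) — it
is print's normalisation (Def. 2.5). Witness: `model₂Q p`. [cite: MochizukiEtTh2009, Def 2.5 p.39] -/
theorem _root_.Literature.AnabelianGeometry.EtaleTheta.ThetaSetting.not_forall_Kdd_eq_of_hYcl :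
    ¬ ∀ D : ThetaSetting p, D.IsEtThOrigin →
      (D.DtpY.map D.toHat.toMonoidHom).topologicalClosure ≤
        D.DtpY.map D.toHat.toMonoidHom ⊔ (⁅⁅D.DeltaHat, D.DeltaHat⁆, D.DeltaHat⁆).topologicalClosure →
      (∀ N, (D.thetaToEll.comp D.toTheta).ker ⊓ D.GtpY ≤ D.GtpYN N) → D.Kdd = D.K :=
  fun h => model₂Q_Kdd_ne p
    (h (ThetaSetting.model₂Q p) (ThetaSetting.model₂Q_isEtThOrigin p) (hYcl_model₂Q p)
      (ker_toEll_inf_GtpY_le_GtpYN_model₂Q p))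

/-- **Joint satisfiability census for clause (a) in the presence of `hYcl`**: {root, guard, `hYcl`, clause (b)}
has a model of "`K = K̈`" (`model₂ p`, abc-iut-L2-d1's `model₂_Kdd_eq`) and a model of its negation (`model₂Q p`).
[cite: MochizukiEtTh2009, Def 2.5 p.39] -/
theorem _root_.Literature.AnabelianGeometry.EtaleTheta.ThetaSetting.KddClause_independent_hYcl :
    (∃ D : ThetaSetting p, D.IsEtThOrigin ∧
      (D.DtpY.map D.toHat.toMonoidHom).topologicalClosure ≤
        D.DtpY.map D.toHat.toMonoidHom ⊔ (⁅⁅D.DeltaHat, D.DeltaHat⁆, D.DeltaHat⁆).topologicalClosure ∧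
      (∀ N, (D.thetaToEll.comp D.toTheta).ker ⊓ D.GtpY ≤ D.GtpYN N) ∧ D.Kdd = D.K) ∧
    ∃ D : ThetaSetting p, D.IsEtThOrigin ∧
      (D.DtpY.map D.toHat.toMonoidHom).topologicalClosure ≤
        D.DtpY.map D.toHat.toMonoidHom ⊔ (⁅⁅D.DeltaHat, D.DeltaHat⁆, D.DeltaHat⁆).topologicalClosure ∧
      (∀ N, (D.thetaToEll.comp D.toTheta).ker ⊓ D.GtpY ≤ D.GtpYN N) ∧ D.Kdd ≠ D.K :=
  ⟨⟨ThetaSetting.model₂ p, ThetaSetting.model₂_isEtThOrigin p, hYcl_model₂ p, ker_toEllM₂_inf_GtpY_le_YN₂ p,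
      model₂_Kdd_eq p⟩,
    ⟨ThetaSetting.model₂Q p, ThetaSetting.model₂Q_isEtThOrigin p, hYcl_model₂Q p,
      ker_toEll_inf_GtpY_le_GtpYN_model₂Q p, model₂Q_Kdd_ne p⟩⟩

end Literature.AnabelianGeometry.EtaleTheta.SettingModel

end
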